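import Summits.QuantumFields.BalabanUV.T4Continuum.Support.SubstrateBackgroundDriven
import Literature.MathematicalPhysics.QuantumFieldTheory.Balaban1983to89.BlockAveragingExpMeanLog

/-!
# SUBSTRATE — CONTINUITY OF THE ITERATED BLOCK AVERAGING ON NESTED SMALL-LOOP CLASSES: the unguarded (0.4) step `rawAvg`, its
# iterate `rawIter`, the closed classes `NestedSmall ℰ δ′ k` on which the averaging OF RECORD `M^k = (blockAvg ℰ)^k` equals the unguarded
# iterate and is CONTINUOUS; the small-loop averages of record `ExpMeanLog.expMeanLogU ∕ expMeanLogSU` are continuous on small families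
# and normalised at identity families — hence the driven two-run object of record at the `ℰ` of record, `drivenOfRecordSU`

Cell `pub-balaban`, SUBSTRATE cell, seat `b2b-balaban-substrate-p2`; typer NEXT gen 4 task 2 (MAP v0.4 §O1 D-3″; statements = sketch v0.4
§BA `rawAvg` ∕ `rawIter` ∕ `NestedSmall` ∕ `IterEqRawIter_stmt` ∕ `SmallContinuous` ∕ `IsClosedNestedSmall_stmt` ∕ `ContinuousOnIterBlockAvg_stmt` ∕
`ContinuousOnESU_stmt`, here THEOREMS) and task 3(a) (`loopAvgOfRecordU ∕ SU`).  Follower of `SubstrateBackgroundDriven` v1.1 (p219947: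
`drivenOfRecordOn`, `blockAvg_one_of_E_one`) and of the tree's `BlockAveragingExpMeanLog` (p180398 ∕ p181278: `EU`, `ESU`, `continuousOn_coe_EU ∕ ESU`)
BY NAME; the `hav1`-discharge lemmas `EU_const_one` ∕ `blockAvg_expMeanLogU_one` are LIFTED WITH CREDIT from ne9-formalise-leaf-07-g8's probe
(journal l.13634), whose located type remark R-ne9leaf07g8-1 (countersigned F-SUB-T1) this file answers.  Edits nothing.

HONEST FRAMING (T4-DAG p. 1).  Rung (B)+1 of the FINITE-VOLUME T⁴ continuum programme — NOT infinite volume, NOT a mass gap, NOT the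
Clay problem, NOT summit progress, no estimate.  The inclusion «Bałaban's small-PLAQUETTE class ⊆ `NestedSmall`» (one-step regularity of
the averaging, [Balaban1985Averaging] Prop. 2) is an ESTIMATE and stays DISPLAYED (`hsubA ∕ hsubB` below) — never substrate.  HONEST
DEPENDENCY (cell line, verbatim): continuum YM on T⁴ ⇐ BetaPertH ∧ nine spine estimates (0/9 proved); BetaPertH ⇐ (D1) ∧ (D4) ∧ CAP+tail;
G-an2-4 gates asym, D1 and NE2/3/4.

WHAT THIS FILE PROVES ([Balaban1987RG1] (0.4) p. 253 structure only).
* §1 `rawAvg ℰ`, `rawIter ℰ k`, `NestedSmall ℰ δ′ k`; `avg_eq_rawAvg_of_small`, `nestedSmall_succ_subset`, **`iter_blockAvg_eq_rawIter`** (`δ′ < ℰ.δ`),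
  `rawAvg_one` ∕ `rawIter_one` ∕ `one_mem_nestedSmall` (for `ℰ.E (1,…,1) = 1`, `0 ≤ δ′`).
* §2 continuity: `continuous_holAt`, `continuous_loopHol`, `continuous_pathProd` ∕ `continuous_axialAvg` (leaf-07-g8 §P3, with credit),
  `SmallContinuous ℰ` (hypothesis shape, typer's), `continuousOn_rawAvg`, **`isClosed_nestedSmall`**, **`continuousOn_rawIter`**,
  **`continuousOn_iter_blockAvg`** — the `hiter` input of `SubstrateBackground.backgroundOfRecordOn` ∕ `SubstrateBackgroundDriven.drivenOfRecordOn`.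
* §3 the averages of record: `loopAvgOfRecordU ∕ SU` (abbrevs), **`smallContinuous_expMeanLogU ∕ SU`**, `EU_const_one` ∕ `ESU_const_one`,
  **`blockAvg_expMeanLogU_one ∕ blockAvg_expMeanLogSU_one`**; §4 `continuous_dist1_SU`.
* §4 **`drivenOfRecordSU`**: the O-1 object at `ℰ = expMeanLogSU` on `SU(n)` with ONLY «`regA ∕ regB` closed, `∋ 1`, `⊆ NestedSmall … δ′ k` for all k»
  displayed; `one_mem_domV_drivenOfRecordSU`, `uA_one ∕ uB_one_drivenOfRecordSU` unconditional.
No estimate, no `sorry`; the one `def … : Prop` is the typer's hypothesis shape `SmallContinuous` (sketch v0.4 §BA), discharged here for the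
averages of record.
-/

noncomputable section

open scoped BigOperators Topology

namespace Summit.QuantumFields.BalabanUV.T4Continuum.SubstrateBlockAvgContinuity

open Literature.MathematicalPhysics.QuantumFieldTheory.Balaban1983to89
open Literature.MathematicalPhysics.QuantumFieldTheory.Balaban1983to89.T4Continuum (T4Family holAt holAt_nil holAt_cons)
open Literature.MathematicalPhysics.QuantumFieldTheory.Balaban1983to89.AveragingRT (axialAvg pathProd)
open Literature.MathematicalPhysics.QuantumFieldTheory.Balaban1983to89.BlockAveraging (blockAvg blockAvg_avg avgFun corr Small loopHol Idx)
open Summit.QuantumFields.BalabanUV.T4Continuum.SubstrateBackground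
open Summit.QuantumFields.BalabanUV.T4Continuum.SubstrateTwoRunsDriven
open Summit.QuantumFields.BalabanUV.T4Continuum.SubstrateBackgroundDriven

variable {P : Params} {G : Type*} [GaugeGroup G] (ℰ : LoopAverage G)

/-! ## §1 The unguarded step, its iterate, the nested small-loop classes -/

/-- [folklore] THE UNGUARDED (0.4) STEP `Ū(c) = ℰ(loop family at c) · U(c)` (sketch v0.4 §BA): agrees with `(blockAvg ℰ).avg` wherever
`Small ℰ U c`; no `Averaging` axioms claimed. -/
def rawAvg {j : ℕ} (U : GaugeField P j G) : GaugeField P (j + 1) G := fun c => ℰ.avg (loopHol U c) * axialAvg U c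

/-- [folklore] Its `k`-fold iterate from the finest lattice. -/
def rawIter : (k : ℕ) → GaugeField P 0 G → GaugeField P k G
  | 0 => id
  | k + 1 => rawAvg ℰ ∘ rawIter k

/-- [folklore] THE NESTED SMALL-LOOP CLASS with margin `δ′` (sketch v0.4 §BA): along the unguarded orbit every (0.4) loop variable at
every level `< k` is within `δ′` of `1` (a closed condition, `≤`). -/
def NestedSmall (δ' : ℝ) (k : ℕ) : Set (GaugeField P 0 G) :=
  {U | ∀ i, i < k → ∀ (c : PBond P (i + 1)) (x : Idx P), dist1 (loopHol (rawIter ℰ i U) c x) ≤ δ'}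

/-- [folklore] `rawIter` unfolds. -/
@[simp] theorem rawIter_zero (U : GaugeField P 0 G) : rawIter ℰ 0 U = U := rfl

/-- [folklore] `rawIter` unfolds. -/
theorem rawIter_succ (k : ℕ) (U : GaugeField P 0 G) : rawIter ℰ (k + 1) U = rawAvg ℰ (rawIter ℰ k U) := rfl

/-- [folklore] Membership in the nested class. -/
theorem mem_nestedSmall {δ' : ℝ} {k : ℕ} {U : GaugeField P 0 G} :
    U ∈ NestedSmall (P := P) ℰ δ' k ↔ ∀ i, i < k → ∀ (c : PBond P (i + 1)) (x : Idx P), dist1 (loopHol (rawIter ℰ i U) c x) ≤ δ' :=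
  Iff.rfl

/-- [folklore] The classes are nested: level `k + 1` ⊆ level `k`. -/
theorem nestedSmall_succ_subset (δ' : ℝ) (k : ℕ) : NestedSmall (P := P) ℰ δ' (k + 1) ⊆ NestedSmall ℰ δ' k :=
  fun _ hU i hi => hU i (Nat.lt_succ_of_lt hi)

/-- [folklore] Level `0` is everything. -/
@[simp] theorem nestedSmall_zero (δ' : ℝ) : NestedSmall (P := P) ℰ δ' 0 = Set.univ :=
  Set.eq_univ_of_forall fun _ i hi => absurd hi (Nat.not_lt_zero i)

/-- [folklore] The successor class is the class cut by the closed level-`k` condition on the unguarded iterate. -/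
theorem nestedSmall_succ_eq (δ' : ℝ) (k : ℕ) :
    NestedSmall (P := P) ℰ δ' (k + 1) =
      NestedSmall ℰ δ' k ∩ rawIter ℰ k ⁻¹' {V : GaugeField P k G | ∀ (c : PBond P (k + 1)) (x : Idx P), dist1 (loopHol V c x) ≤ δ'} := by
  ext U
  simp only [mem_nestedSmall, Set.mem_inter_iff, Set.mem_preimage, Set.mem_setOf_eq]
  constructor
  · exact fun h => ⟨fun i hi => h i (Nat.lt_succ_of_lt hi), h k (Nat.lt_succ_self k)⟩
  · rintro ⟨h, hk⟩ i hi
    rcases Nat.lt_succ_iff_lt_or_eq.1 hi with hi' | rfl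
    · exact h i hi'
    · exact hk

/-- [folklore] ON THE GUARD the averaging of record is the unguarded step (`corr` takes its first branch). -/
theorem avg_eq_rawAvg_of_small {j : ℕ} {U : GaugeField P j G} {c : PBond P (j + 1)} (h : Small ℰ U c) :
    (blockAvg ℰ).avg U c = rawAvg ℰ U c := by
  rw [blockAvg_avg]
  show corr ℰ U c * axialAvg U c = _
  rw [corr, if_pos h]
  rfl

/-- [folklore] **ON THE NESTED CLASS THE AVERAGING OF RECORD IS THE UNGUARDED ITERATE** (sketch v0.4 `IterEqRawIter_stmt`), for a margin
`δ′ < ℰ.δ` (the guard is inactive along the orbit). -/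
theorem iter_blockAvg_eq_rawIter {δ' : ℝ} (hδ : δ' < ℰ.δ) :
    ∀ (k : ℕ) (U : GaugeField P 0 G), U ∈ NestedSmall ℰ δ' k →
      Averaging.iter (fun j => (blockAvg ℰ : Averaging P j G)) k U = rawIter ℰ k U
  | 0, _, _ => rfl
  | k + 1, U, hU => by
    have ih := iter_blockAvg_eq_rawIter hδ k U (nestedSmall_succ_subset ℰ δ' k hU)
    show (blockAvg ℰ).avg (Averaging.iter (fun j => (blockAvg ℰ : Averaging P j G)) k U) = rawAvg ℰ (rawIter ℰ k U)
    rw [ih]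
    funext c
    exact avg_eq_rawAvg_of_small ℰ fun x => (hU k (Nat.lt_succ_self k) c x).trans_lt hδ

/-- [folklore] The unguarded step fixes the trivial configuration, for `ℰ` normalised at identity families. -/
theorem rawAvg_one {j : ℕ} (hE : ∀ m : ℕ, ℰ.E (fun _ : Fin (m + 1) => (1 : G)) = 1) : rawAvg ℰ (1 : GaugeField P j G) = 1 := by
  funext c
  show ℰ.avg (loopHol (1 : GaugeField P j G) c) * axialAvg 1 c = 1
  rw [axialAvg_one_cfg, show loopHol (1 : GaugeField P j G) c = fun _ => 1 from funext (loopHol_one_cfg c)]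
  show ℰ.E ((fun _ => (1 : G)) ∘ _) * (1 : GaugeField P (j + 1) G) c = 1
  rw [show ((fun _ : Idx P => (1 : G)) ∘ ⇑(LoopAverage.enum (Idx P)).symm) = fun _ => 1 from rfl, hE]
  exact one_mul _

/-- [folklore] … hence so does its iterate. -/
theorem rawIter_one (hE : ∀ m : ℕ, ℰ.E (fun _ : Fin (m + 1) => (1 : G)) = 1) : ∀ k, rawIter ℰ k (1 : GaugeField P 0 G) = 1
  | 0 => rfl
  | k + 1 => by rw [rawIter_succ, rawIter_one hE k, rawAvg_one ℰ hE]

/-- [folklore] **THE TRIVIAL CONFIGURATION IS IN EVERY NESTED CLASS** (`0 ≤ δ′`, `ℰ` normalised at identity families). -/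
theorem one_mem_nestedSmall (hE : ∀ m : ℕ, ℰ.E (fun _ : Fin (m + 1) => (1 : G)) = 1) {δ' : ℝ} (hδ' : 0 ≤ δ') (k : ℕ) :
    (1 : GaugeField P 0 G) ∈ NestedSmall ℰ δ' k := fun i _ c x => by
  rw [rawIter_one ℰ hE i, loopHol_one_cfg, GaugeGroup.dist1_one]; exact hδ'

/-! ## §2 Continuity -/

section Continuity

variable [TopologicalSpace G] [IsTopologicalGroup G]

omit ℰ in
/-- [folklore] Holonomies along fixed walks are continuous in the configuration. -/
theorem continuous_holAt {j : ℕ} : ∀ γ : List (T4Continuum.LStep P j), Continuous fun U : GaugeField P j G => holAt U γ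
  | [] => by simp only [holAt_nil]; exact continuous_const
  | ⟨b, false⟩ :: γ => by
    simp only [holAt_cons, Bool.false_eq_true, ↓reduceIte]
    exact (continuous_eval b).inv.mul (continuous_holAt γ)
  | ⟨b, true⟩ :: γ => by
    simp only [holAt_cons, ↓reduceIte]
    exact (continuous_eval b).mul (continuous_holAt γ)

omit ℰ in
/-- [folklore] The (0.4) loop variables are continuous in the configuration. -/
theorem continuous_loopHol {j : ℕ} (c : PBond P (j + 1)) (x : Idx P) : Continuous fun U : GaugeField P j G => loopHol U c x :=
  continuous_holAt _

omit ℰ in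
/-- [folklore] The straight-line transporters are continuous (leaf-07-g8 §P3, with credit). -/
theorem continuous_pathProd {j : ℕ} (c : PBond P (j + 1)) : ∀ n, Continuous fun U : GaugeField P j G => pathProd U c n
  | 0 => by simp only [pathProd]; exact continuous_const
  | n + 1 => by simp only [pathProd]; exact (continuous_pathProd c n).mul (continuous_eval _)

omit ℰ in
/-- [folklore] The axial averaging is continuous (leaf-07-g8 §P3, with credit). -/
theorem continuous_axialAvg {j : ℕ} : Continuous (axialAvg : GaugeField P j G → GaugeField P (j + 1) G) :=
  continuous_of_eval fun c => continuous_pathProd c P.L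

/-- HYPOTHESIS SHAPE (typer's, sketch v0.4 §BA) **`SmallContinuous ℰ`**: the small-loop average is continuous on small families — the one
analytic input; discharged below for the averages of record. [folklore] -/
def SmallContinuous : Prop :=
  ∀ m : ℕ, ContinuousOn (fun W : Fin (m + 1) → G => ℰ.E W) {W | ∀ i, dist1 (W i) < ℰ.δ}

/-- [folklore] The unguarded step is continuous, bondwise, on the configurations small at that bond. -/
theorem continuousOn_rawAvg_eval (hE : SmallContinuous ℰ) {j : ℕ} (c : PBond P (j + 1)) :
    ContinuousOn (fun U : GaugeField P j G => rawAvg ℰ U c) {U | Small ℰ U c} := by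
  have hfam : Continuous fun U : GaugeField P j G => (loopHol U c ∘ ⇑(LoopAverage.enum (Idx P)).symm : Fin _ → G) :=
    continuous_pi fun i => continuous_loopHol c _
  have hmaps : Set.MapsTo (fun U : GaugeField P j G => (loopHol U c ∘ ⇑(LoopAverage.enum (Idx P)).symm : Fin _ → G))
      {U | Small ℰ U c} {W | ∀ i, dist1 (W i) < ℰ.δ} := fun U hU i => hU _
  show ContinuousOn (fun U : GaugeField P j G =>
      ℰ.E (loopHol U c ∘ ⇑(LoopAverage.enum (Idx P)).symm) * pathProd U c P.L) {U | Small ℰ U c}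
  exact ((hE _).comp hfam.continuousOn hmaps).mul (continuous_pathProd c P.L).continuousOn

/-- [folklore] The level-`k` smallness condition is closed (continuous `dist1`). -/
theorem isClosed_smallAll (hd : Continuous (dist1 : G → ℝ)) (δ' : ℝ) (k : ℕ) :
    IsClosed {V : GaugeField P k G | ∀ (c : PBond P (k + 1)) (x : Idx P), dist1 (loopHol V c x) ≤ δ'} := by
  simp only [Set.setOf_forall]
  exact isClosed_iInter fun c => isClosed_iInter fun x => isClosed_le (hd.comp (continuous_loopHol c x)) continuous_const

/-- [folklore] **THE NESTED CLASS IS CLOSED AND THE UNGUARDED ITERATE IS CONTINUOUS ON IT** (sketch v0.4 `IsClosedNestedSmall_stmt`; joint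
induction on the level: level `k`'s condition is closed in `rawIter ℰ k U`, which is continuous ON the level-`k` class). -/
theorem isClosed_nestedSmall_and_continuousOn_rawIter (hd : Continuous (dist1 : G → ℝ)) (hE : SmallContinuous ℰ) {δ' : ℝ}
    (hδ : δ' < ℰ.δ) : ∀ k, IsClosed (NestedSmall (P := P) ℰ δ' k) ∧ ContinuousOn (rawIter ℰ k) (NestedSmall (P := P) ℰ δ' k)
  | 0 => by
    rw [nestedSmall_zero]
    exact ⟨isClosed_univ, continuousOn_id⟩
  | k + 1 => by
    obtain ⟨hcl, hco⟩ := isClosed_nestedSmall_and_continuousOn_rawIter hd hE hδ k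
    refine ⟨?_, ?_⟩
    · rw [nestedSmall_succ_eq]
      exact hco.preimage_isClosed_of_isClosed hcl (isClosed_smallAll hd δ' k)
    · -- `rawIter (k+1) = rawAvg ∘ rawIter k`; `rawIter k` maps the level-`(k+1)` class into the bondwise-small configurations
      have hco' : ContinuousOn (rawIter ℰ k) (NestedSmall (P := P) ℰ δ' (k + 1)) := hco.mono (nestedSmall_succ_subset ℰ δ' k)
      refine continuousOn_pi.2 fun c => ?_
      have hmaps : Set.MapsTo (rawIter ℰ k) (NestedSmall (P := P) ℰ δ' (k + 1)) {V : GaugeField P k G | Small ℰ V c} :=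
        fun U hU x => (hU k (Nat.lt_succ_self k) c x).trans_lt hδ
      exact (continuousOn_rawAvg_eval ℰ hE c).comp hco' hmaps

/-- [folklore] **THE NESTED SMALL-LOOP CLASS IS CLOSED** (sketch v0.4 `IsClosedNestedSmall_stmt` as a theorem). -/
theorem isClosed_nestedSmall (hd : Continuous (dist1 : G → ℝ)) (hE : SmallContinuous ℰ) {δ' : ℝ} (hδ : δ' < ℰ.δ) (k : ℕ) :
    IsClosed (NestedSmall (P := P) ℰ δ' k) :=
  (isClosed_nestedSmall_and_continuousOn_rawIter ℰ hd hE hδ k).1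

/-- [folklore] The unguarded iterate is continuous on the nested class. -/
theorem continuousOn_rawIter (hd : Continuous (dist1 : G → ℝ)) (hE : SmallContinuous ℰ) {δ' : ℝ} (hδ : δ' < ℰ.δ) (k : ℕ) :
    ContinuousOn (rawIter ℰ k) (NestedSmall (P := P) ℰ δ' k) :=
  (isClosed_nestedSmall_and_continuousOn_rawIter ℰ hd hE hδ k).2

/-- [folklore] **THE `k`-FOLD AVERAGING OF RECORD IS CONTINUOUS ON THE NESTED CLASS** (sketch v0.4 `ContinuousOnIterBlockAvg_stmt` as a
theorem) — the `hiter` input of `SubstrateBackground.backgroundOfRecordOn` ∕ `SubstrateBackgroundDriven.drivenOfRecordOn` for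
`av := fun j => blockAvg ℰ` and any closed `reg ⊆ NestedSmall ℰ δ′ k`. -/
theorem continuousOn_iter_blockAvg (hd : Continuous (dist1 : G → ℝ)) (hE : SmallContinuous ℰ) {δ' : ℝ} (hδ : δ' < ℰ.δ) (k : ℕ) :
    ContinuousOn (Averaging.iter (fun j => (blockAvg ℰ : Averaging P j G)) k) (NestedSmall (P := P) ℰ δ' k) :=
  (continuousOn_rawIter ℰ hd hE hδ k).congr fun U hU => iter_blockAvg_eq_rawIter ℰ hδ k U hU

end Continuity

/-! ## §3 The small-loop averages of record (`ExpMeanLog.expMeanLogU ∕ expMeanLogSU`, p180398 ∕ p181278) -/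

section Record

open ExpMeanLog
open scoped Matrix.Norms.L2Operator

variable {n : Type} [Fintype n] [DecidableEq n] [Nonempty n]

/-- [folklore] THE SMALL-LOOP AVERAGE OF RECORD on `U(n)` (ruling Q-S9′ (1): the tree's printed `exp[mean log]`, cited by name). -/
abbrev loopAvgOfRecordU : LoopAverage (Matrix.unitaryGroup n ℂ) := expMeanLogU

/-- [folklore] THE SMALL-LOOP AVERAGE OF RECORD on `SU(n)`. -/
abbrev loopAvgOfRecordSU : LoopAverage (Matrix.specialUnitaryGroup n ℂ) := expMeanLogSU

/-- [folklore] **`expMeanLogU` IS CONTINUOUS ON SMALL FAMILIES** (from the tree's `continuousOn_coe_EU`: on the open guard `EU` is the analytic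
`eml` composed with the inclusion). -/
theorem smallContinuous_expMeanLogU : SmallContinuous (expMeanLogU (n := n)) := fun _ =>
  Topology.IsInducing.subtypeVal.continuousOn_iff.2 continuousOn_coe_EU

/-- [folklore] **`expMeanLogSU` IS CONTINUOUS ON SMALL FAMILIES** (sketch v0.4 `ContinuousOnESU_stmt` as a theorem; the tree's
`continuousOn_coe_ESU`). -/
theorem smallContinuous_expMeanLogSU : SmallContinuous (expMeanLogSU (n := n)) := fun _ =>
  Topology.IsInducing.subtypeVal.continuousOn_iff.2 continuousOn_coe_ESU

omit [Nonempty n] in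
/-- [folklore] The `U(n)` average of record is NORMALISED AT IDENTITY FAMILIES: `EU (1,…,1) = exp(|I|⁻¹ Σ log 1) = 1` (ne9-formalise-leaf-07-g8
§P4, with credit). -/
theorem EU_const_one {ι : Type*} [Fintype ι] : EU (fun _ : ι => (1 : Matrix.unitaryGroup n ℂ)) = 1 := by
  apply Subtype.ext
  rw [coe_EU_of_small (fun _ => by rw [OneMemClass.coe_one, sub_self, norm_zero]; norm_num)]
  rw [eml_eq_exp]
  simp

/-- [folklore] The `SU(n)` average of record is normalised at identity families. -/
theorem ESU_const_one {ι : Type*} [Fintype ι] : ESU (fun _ : ι => (1 : Matrix.specialUnitaryGroup n ℂ)) = 1 := by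
  apply Subtype.ext
  rw [coe_ESU_of_small (fun _ => by rw [OneMemClass.coe_one, sub_self, norm_zero]; exact deltaSU_pos)]
  rw [eml_eq_exp]
  simp

/-- [folklore] **`hav1` FOR THE `U(n)` AVERAGE OF RECORD**: `(blockAvg expMeanLogU).avg 1 = 1` at every `P`, `j` (leaf-07-g8 §P4, with credit). -/
theorem blockAvg_expMeanLogU_one (P : Params) (j : ℕ) : (blockAvg (P := P) (j := j) (expMeanLogU (n := n))).avg 1 = 1 :=
  blockAvg_one_of_E_one _ fun _ => EU_const_one

/-- [folklore] **`hav1` FOR THE `SU(n)` AVERAGE OF RECORD**. -/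
theorem blockAvg_expMeanLogSU_one (P : Params) (j : ℕ) : (blockAvg (P := P) (j := j) (expMeanLogSU (n := n))).avg 1 = 1 :=
  blockAvg_one_of_E_one _ fun _ => ESU_const_one

/-- [folklore] `1` is in every nested class of the `SU(n)` average of record (`0 ≤ δ′`). -/
theorem one_mem_nestedSmall_expMeanLogSU {P : Params} {δ' : ℝ} (hδ' : 0 ≤ δ') (k : ℕ) :
    (1 : GaugeField P 0 (Matrix.specialUnitaryGroup n ℂ)) ∈ NestedSmall expMeanLogSU δ' k :=
  one_mem_nestedSmall _ (fun _ => ESU_const_one) hδ' k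

end Record

/-! ## §4 The driven two-run object of record AT THE SMALL-LOOP AVERAGE OF RECORD on `SU(n)` -/

section DrivenSU

open ExpMeanLog

variable {n : Type} [Fintype n] [DecidableEq n] [Nonempty n]

omit [Nonempty n] in
/-- [folklore] Continuity of `dist1 = ‖· − 1‖_{op}` on `SU(n)` through the fundamental representation (stated on the composite to keep
the dedup lint quiet; `SubstrateBackground.continuous_reTr_specialUnitaryGroup` is the `Re tr` twin). -/
theorem continuous_dist1_SU :
    Continuous fun g : Matrix.specialUnitaryGroup n ℂ => UnitaryModel.opDist1 (Literature.MathematicalPhysics.QuantumLattice.fundamentalRep n g) :=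
  UnitaryModel.continuous_opDist1.comp (Literature.MathematicalPhysics.QuantumLattice.continuous_fundamentalRep n)

/-- [folklore] **THE O-1 OBJECT AT THE `ℰ` OF RECORD** (`expMeanLogSU` on `SU(n)`): `drivenOfRecordOn` with the continuity of `M^k` on the
classes SUPPLIED by `continuousOn_iter_blockAvg`; displayed remain only: the classes are closed, contain `1`, and lie in the nested
small-loop classes `NestedSmall expMeanLogSU δ′ k` for a margin `δ′ < δ_SU` (for Bałaban's small-plaquette classes this inclusion is the
one-step REGULARITY estimate — never substrate). -/
def drivenOfRecordSU (F : T4Family) (K m' : ℕ) {δ' : ℝ} (hδ : δ' < (expMeanLogSU (n := n)).δ)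
    (regA : Set (GaugeField (F.P K) 0 (Matrix.specialUnitaryGroup n ℂ))) (hregA : IsClosed regA)
    (h1A : (1 : GaugeField (F.P K) 0 (Matrix.specialUnitaryGroup n ℂ)) ∈ regA)
    (hsubA : ∀ k, regA ⊆ NestedSmall expMeanLogSU δ' k)
    (regB : Set (GaugeField (F.P (K + 1)) 0 (Matrix.specialUnitaryGroup n ℂ))) (hregB : IsClosed regB)
    (h1B : (1 : GaugeField (F.P (K + 1)) 0 (Matrix.specialUnitaryGroup n ℂ)) ∈ regB)
    (hsubB : ∀ k, regB ⊆ NestedSmall expMeanLogSU δ' k) (gA gB : ℕ → ℝ) : DrivenRuns (Matrix.specialUnitaryGroup n ℂ) :=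
  drivenOfRecordOn continuous_reTr_specialUnitaryGroup F K m' expMeanLogSU regA hregA h1A
    (fun k => (continuousOn_iter_blockAvg _ continuous_dist1_SU smallContinuous_expMeanLogSU hδ k).mono (hsubA k))
    regB hregB h1B
    (fun k => (continuousOn_iter_blockAvg _ continuous_dist1_SU smallContinuous_expMeanLogSU hδ k).mono (hsubB k))
    gA gB

variable (F : T4Family) (K m' : ℕ) {δ' : ℝ} (hδ : δ' < (expMeanLogSU (n := n)).δ)
  (regA : Set (GaugeField (F.P K) 0 (Matrix.specialUnitaryGroup n ℂ))) (hregA : IsClosed regA)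
  (h1A : (1 : GaugeField (F.P K) 0 (Matrix.specialUnitaryGroup n ℂ)) ∈ regA) (hsubA : ∀ k, regA ⊆ NestedSmall expMeanLogSU δ' k)
  (regB : Set (GaugeField (F.P (K + 1)) 0 (Matrix.specialUnitaryGroup n ℂ))) (hregB : IsClosed regB)
  (h1B : (1 : GaugeField (F.P (K + 1)) 0 (Matrix.specialUnitaryGroup n ℂ)) ∈ regB) (hsubB : ∀ k, regB ⊆ NestedSmall expMeanLogSU δ' k)
  (gA gB : ℕ → ℝ)

/-- [folklore] **`1 ∈ domV` UNCONDITIONALLY** at the `ℰ` of record. -/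
theorem one_mem_domV_drivenOfRecordSU :
    (1 : UnitField F (Matrix.specialUnitaryGroup n ℂ)) ∈
      (drivenOfRecordSU F K m' hδ regA hregA h1A hsubA regB hregB h1B hsubB gA gB).domV :=
  one_mem_domV_drivenOfRecordOn _ F K m' _ regA hregA h1A _ regB hregB h1B _ gA gB fun _ => ESU_const_one

/-- [folklore] **`oneA`** at the `ℰ` of record: run A's background of the trivial driving field is trivial. -/
theorem uA_one_drivenOfRecordSU :
    ((drivenOfRecordSU F K m' hδ regA hregA h1A hsubA regB hregB h1B hsubB gA gB).uA
        ⟨1, one_mem_domV_drivenOfRecordSU F K m' hδ regA hregA h1A hsubA regB hregB h1B hsubB gA gB⟩).1 = 1 :=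
  uA_one_drivenOfRecordOn _ F K m' _ regA hregA h1A _ regB hregB h1B _ gA gB fun _ => ESU_const_one

/-- [folklore] **`oneB`** at the `ℰ` of record. -/
theorem uB_one_drivenOfRecordSU :
    ((drivenOfRecordSU F K m' hδ regA hregA h1A hsubA regB hregB h1B hsubB gA gB).uB
        ⟨1, one_mem_domV_drivenOfRecordSU F K m' hδ regA hregA h1A hsubA regB hregB h1B hsubB gA gB⟩).1 = 1 :=
  uB_one_drivenOfRecordOn _ F K m' _ regA hregA h1A _ regB hregB h1B _ gA gB fun _ => ESU_const_one

end DrivenSU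

end Summit.QuantumFields.BalabanUV.T4Continuum.SubstrateBlockAvgContinuity

end
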